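import Summits.HodgeConjecture.HodgeConjecture.Theorems.VHCAbelianSchemesRoadSecantQuotientAnchorPinnedDefsPrime
import Summits.HodgeConjecture.HodgeConjecture.Theorems.VHCAbelianSchemesRoadSecantQuotientAnchorPinnedMarkman
import Summits.HodgeConjecture.HodgeConjecture.Theorems.Ring2AbelianAllOneTensorWeilClassCarrierDefs
import HarnessLib

/-!
# Road b02 (`VHCAbelianSchemesRoad`, D-0059) — lane W1, stub 2a‴ `stub_anchorCarrier_63_secantQuotientPinnedPrime` of the PRIMED crux
# `SemiregularSheafRepresentativesTwPrimeAtDiag` (item stmt-HodgeConjecture-20707, skeleton v3.3): print's pinned claim L1″ READ AT THE PRIMED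
# DOOR `tw(C, AdmTw′)`, the SEEDS it supplies at every level, and the door-generic TRANSFER junction «seeds ∧ transfer ⟹ 2a» (fact-free)

research route conditional on HC_CM; not a corollary; Q11.4-sentence-2 already refuted in dim ≥ 3.

THEOREMS ONLY (no definition, no new named fact; the claim-tagged L1″ `HodgeTheory.Markman2025_secantQuotient_twistedCarrier_onJacobian_pinned C Adm`
— PREPRINT arXiv:2502.03415, under review — enters as a HYPOTHESIS by name only; `HC_CM` nowhere; the print leaf `TwistedPerfectDoorPrime` (item 20706)
is not restated). Director-hodge ruling R10.1 (S2) ∕ ring-2 LEAD 158 proposal L158.1: the `(6,3)` anchored-carrier stub of skeleton v3.3,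
`∀ C, SecantQuotientAnchorCarrier63PinnedPrime C` (`…AnchorPinnedDefsPrime`, p547560: `AnchoredCarrierAt (tw C AdmTw′) 6 3 𝔄^pin 𝔖^pin`), is to be
read as «print ∧ ONE named ∀-node». This file is the theorem half (the node is NAMED in the companion definitions file
`…SecantQuotientAnchorPinnedTransferDefs`, which turns §4 into the by-name junction):

* §1 L1″ is MONOTONE in the admissibility notion (its only `Adm`-occurrence is the positive `twistedReflexiveClass C Adm` of the every-copy
  datum): `markmanPinned_mono_door`; in particular **L1″ at the primed door `AdmTw′ := gluableSigmaAdmissible ∨ bfSingleAdmissible′` implies L1″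
  at the door of record `AdmTw`** (`markmanPinned_admTw_of_admTw'`) — the excess of L1″(AdmTw′) over L1″(AdmTw) is exactly «Markman's reflexive
  secant sheaf is admissible through the σ-gluable disjunct `gluableSigmaAdmissible` or through Buchweitz–Flenner data on an INITIAL SEGMENT»
  (door-slice audit VET §2 ∕ tribunal J A2: the σ-disjunct is the one used; §9.3 Lemma 9.3.11 with Remark 9.3.7).
* §2 (i) FORMAL — b02 g88's P1″ chain (`…AnchorPinnedMarkman`, p513733) is door-GENERIC in `Adm`; instantiated at `Adm := AdmTw′`: 2a‴ is MET AT
  PRINT'S ANCHOR IN PRINT'S DIRECTION modulo L1″(C, AdmTw′) (`exists_anchoredDatum_secantQuotientPinnedPrime_of_pinned`), the pinned anchor locus is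
  inhabited, and the defining restriction «no pinned-served fibre» of the primed residual 2b‴ FAILS on a pencil satisfying every binder of the
  `(6,3)` cell in regime 2 (modulo L1″(C, AdmTw′) and the displayed family supply) — verbatim consequences, now keyed to the primed door.
* §3 SEEDS AT EVERY LEVEL: `SecantQuotientDatum.isSecantQuotientAnchorWith_hY` (the identity chart of a datum is a level-`D.d` anchor with its
  class, `Markman2025.IsSecantQuotientAnchorWith`), and `exists_carried_secantQuotientPinned_of_pinned`: modulo L1″(C, Adm), for EVERY even `d ≥ 4`
  there is a level-`d` pinned anchor `(X, θ)` with a pinned-served rational algebraic class `γ` CARRIED by a `tw C Adm`-datum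
  (`γ ∈ AbelianAll.carriedClasses (tw C Adm) 6 3 X θ`) — print's one direction at print's one anchor per level, in the André column's currency.
* §4 THE TRANSFER JUNCTION, door-generic and fact-free: if (a) every even level `d ≥ 4` is SEEDED (some level-`d` pinned anchor carries an
  `𝒪`-datum in some pinned-served rational direction) and (b) `𝒪`-data TRANSFER between pinned-served rational triples `(X, θ, w)`, `(X', θ', w')`
  of the SAME level (the node, displayed here as a hypothesis), then `AnchoredCarrierAt 𝒪 6 3 𝔄^pin 𝔖^pin`; with §3, **L1″(C, Adm) ∧ transfer ⟹
  the 2a-body at `tw C Adm`**, hence at `AdmTw′` the stub 2a‴ and at `AdmTw` the aside 2a″ (`anchoredCarrierAt_secantQuotientPinned_of_pinned_of_transfer`,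
  `secantQuotientAnchorCarrier63PinnedPrime_of_pinned_of_transfer`, `secantQuotientAnchorCarrier63Pinned_of_pinned_of_transfer`). The transfer
  hypothesis at `X = X'`, `θ = θ'` is «the OTHER rational Weil directions at each pinned anchor» (gap (G3)); across anchors of one level it is the
  genericity gap (G1) (special, e.g. hyperelliptic, curves; other level structures). It is NOT in print: deformation of a semiregular twisted sheaf
  along the level-`d` family moves print's direction to finitely many directions per fibre (the Weil local system has finite determinant monodromy),
  the `K`-action reaches the `u⁶`-multiples at CLASS level only, and data do not add (lane W1 evidence n°42 §2 (v)); conversely the 2a-body implies it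
  trivially. So 2a‴ = L1″(AdmTw′) ∧ transfer, and provers stare at the transfer.

Nothing here says L1″, 2a‴, 2a″, the transfer node, any cell, rung, crux, K-SR♭∃, VHC, `HC_AV`, `HC_CM` or HC holds.
References: [cite: Markman2025SecantWeil, §1.3 (p. 5), §1.5 (p. 7), Thm. 1.4.1 (item 4), Thm. 1.5.1, §9.2 Prop. 9.2.2, §9.3 Remark 9.3.7 and Lemma 9.3.11]
[cite: Bloch1972Semiregularity, Remark (7.5)] [cite: BuchweitzFlenner2003, §5 Thm. 5.1] [cite: Pridham2024Semiregularity, Cor. 2.25 and Rem. 2.26]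
[cite: vanGeemen1994HodgeAV, §2.4, Lemma 5.2, 5.4 and Thm. 4.11] [cite: MoonenZarhin1998WeilClasses, §1].
-/

noncomputable section

open CategoryTheory CategoryTheory.Limits AlgebraicGeometry Topology

namespace Summit.HodgeConjecture.HodgeConjecture.Ring2.SemiregularRepresentatives

set_option linter.dupNamespace false -- the cell's namespace repeats the summit name, as in every `Ring2*` file

open Literature.AlgebraicGeometry Literature.AlgebraicGeometry.Motives Literature.AlgebraicGeometry.Motives.AbelianVariety
open Literature.AlgebraicGeometry.HodgeTheory Literature.AlgebraicGeometry.Markman2025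
open Literature.AlgebraicTopology.SingularHomology
open Literature.Barriers.HodgeConjecture (divisorClassesSpan)
open Summit.Ventures.HSemireg (ObjClass)
open Summit.HodgeConjecture.HodgeConjecture.Ring2.AbelianAll (carriedClasses)

variable {C : ChernCharacterBetti} {Adm Adm' : PerfectAdmissibility}

/-! ## §1 L1″ is monotone in the door; L1″ at `AdmTw′` ⟹ L1″ at `AdmTw` -/

/-- **Print's pinned claim L1″ is MONOTONE in the admissibility notion**: a weaker notion `Adm′ ⊇ Adm` makes the every-copy datum easier
(`twistedReflexiveClass.mono`); all other clauses of the claim are door-free. [cite: Markman2025SecantWeil, §1.5 (p. 7) and Lemma 9.3.11]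
[cite: Perry2026Semiregularity, Thm. 1.1 (hypotheses)] -/
theorem markmanPinned_mono_door (hle : ∀ n X₀ I E, Adm n X₀ I E → Adm' n X₀ I E)
    (hM : Markman2025_secantQuotient_twistedCarrier_onJacobian_pinned C Adm) :
    Markman2025_secantQuotient_twistedCarrier_onJacobian_pinned C Adm' := by
  intro d hd h4
  obtain ⟨Cᵥ, hC, 𝒥, hdimJ, Θ, hR, hP, G₁, G₂, h₁, h₂, hc₁, hn₁, hc₂, hn₂, hdisj, hgp, θ₀, γ, hθ₀, hpol, hamp, hhyp, hγQ, hγray,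
    hγW, hcopy⟩ := hM d hd h4
  refine ⟨Cᵥ, hC, 𝒥, hdimJ, Θ, hR, hP, G₁, G₂, h₁, h₂, hc₁, hn₁, hc₂, hn₂, hdisj, hgp, θ₀, γ, hθ₀, hpol, hamp, hhyp, hγQ, hγray, hγW,
    fun X' e ↦ ?_⟩
  obtain ⟨I, κ, c, h3, hκ, hκ3, hκk⟩ := hcopy X' e
  exact ⟨I, κ, c, h3, hκ.mono hle, hκ3, hκk⟩

/-- **L1″ at the PRIMED door implies L1″ at the door of record**: `Markman2025_…_pinned C AdmTw′ ⟹ Markman2025_…_pinned C AdmTw`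
(`bfSingleAdmissible′ ⟹ bfSingleAdmissible`). The excess of the primed reading is exactly «Markman's secant sheaf enters through the σ-gluable
disjunct `gluableSigmaAdmissible`, or through Buchweitz–Flenner data on an initial segment» (door-slice audit; §9.3). [cite: Markman2025SecantWeil, §9.3 Remark 9.3.7 and Lemma 9.3.11]
[cite: BuchweitzFlenner2003, §5 Thm. 5.1] [cite: Pridham2024Semiregularity, Cor. 2.25 and Rem. 2.26] -/
theorem markmanPinned_admTw_of_admTw'
    (hM : Markman2025_secantQuotient_twistedCarrier_onJacobian_pinned C
      (fun n X₀ I E => Summit.Ventures.HSemireg.gluableSigmaAdmissible n X₀ I E ∨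
        Literature.AlgebraicGeometry.HodgeTheory.bfSingleAdmissible' n X₀ I E)) :
    Markman2025_secantQuotient_twistedCarrier_onJacobian_pinned C
      (fun n X₀ I E => Summit.Ventures.HSemireg.gluableSigmaAdmissible n X₀ I E ∨
        Literature.AlgebraicGeometry.HodgeTheory.bfSingleAdmissible n X₀ I E) :=
  markmanPinned_mono_door (fun _ _ _ _ h ↦ h.imp_right bfSingleAdmissible_of_prime) hM

/-! ## §2 (i) FORMAL: the P1″ chain instantiated at `Adm := AdmTw′` -/

section Prime

variable (hM : Markman2025_secantQuotient_twistedCarrier_onJacobian_pinned C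
  (fun n X₀ I E => Summit.Ventures.HSemireg.gluableSigmaAdmissible n X₀ I E ∨
    Literature.AlgebraicGeometry.HodgeTheory.bfSingleAdmissible' n X₀ I E))
include hM

/-- **STUB 2a‴ `SecantQuotientAnchorCarrier63PinnedPrime` IS MET AT PRINT'S ANCHOR IN PRINT'S DIRECTION, modulo L1″ read at the primed door**
— its citation-expected sub-case by INHABITATION: a pinned anchor `(X, θ)`, a pinned-served class `γ` (rational, algebraic) and an `AdmTw′`-admissible
twisted datum ON `X` with `κ₃ = a·γ + c₃·θ³`, `a ≠ 0`, sides on the ray (b02 g88's `exists_anchoredDatum_secantQuotientPinned_of_pinned` at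
`Adm := AdmTw′`). 2a‴ itself (every pinned anchor × every rational pinned-served direction) is NOT claimed.
[cite: Markman2025SecantWeil, Thm. 1.4.1, §1.5 and Lemma 9.3.11] [cite: Bloch1972Semiregularity, Remark (7.5)] -/
theorem exists_anchoredDatum_secantQuotientPinnedPrime_of_pinned :
    ∃ (X : SchemeOver ℂ) (θ : complexBetti X 2) (γ : complexBetti X (2 * 3)),
      secantQuotientAnchorsPinned X θ ∧ γ ∈ secantQuotientServedClassesPinned X θ ∧ IsRationalClass γ ∧ γ ∈ algebraicClasses X 3 ∧
      ∃ (I : Finset ℕ) (κ : (k : ℕ) → complexBetti X (2 * k)) (a : ℂ) (c : ℕ → ℂ),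
        3 ∈ I ∧ twistedReflexiveClass C (fun n X₀ I E => Summit.Ventures.HSemireg.gluableSigmaAdmissible n X₀ I E ∨
          Literature.AlgebraicGeometry.HodgeTheory.bfSingleAdmissible' n X₀ I E) 6 X I κ ∧
        a ≠ 0 ∧ κ 3 = a • γ + c 3 • cupPowTwo θ 3 ∧ ∀ k ∈ I, k ≠ 3 → κ k = c k • cupPowTwo θ k :=
  exists_anchoredDatum_secantQuotientPinned_of_pinned hM

/-- The pinned anchor locus `𝔄^pin` of skeletons v3.1–v3.3 is NOT EMPTY, modulo L1″(C, AdmTw′). [cite: Markman2025SecantWeil, §1.5 (p. 7) and Thm. 1.4.1] -/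
theorem not_forall_not_secantQuotientAnchorsPinned_of_pinnedPrime :
    ¬ ∀ (X : SchemeOver ℂ) (θ : complexBetti X 2), ¬ secantQuotientAnchorsPinned X θ :=
  not_forall_not_secantQuotientAnchorsPinned_of_pinned hM

/-- **The defining restriction of the primed residual 2b‴ (`SecantQuotientResidual63PinnedPrime C`: pencils with NO pinned-served fibre) FAILS
on a pencil satisfying EVERY binder of `LefAtExceptionalRegimeAt _ 6 3` in regime 2**, modulo L1″(C, AdmTw′) and the displayed family supply
`SecantAnchorWeilPencilSupply` (b02 g88's P1″ at `Adm := AdmTw′`; the pencil-level predicate `HasServedFibre` is door-free).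
[cite: Markman2025SecantWeil, Thm. 1.4.1 and §1.5] [cite: vanGeemen1994HodgeAV, Thm. 4.11] [cite: Bloch1972Semiregularity, Remark (7.5)] -/
theorem not_forall_cell_not_hasServedFibre_63_secantQuotientPinned_of_pinnedPrime_of_supply (hsup : SecantAnchorWeilPencilSupply) :
    ¬ ∀ ⦃𝒳 S : SchemeOver ℂ⦄ (f : 𝒳 ⟶ S), IsSmoothProjectiveFamily f 6 → IsQuasiProjectiveOver 𝒳 →
      IrreducibleSpace S.left → IsAffine S.left → AlgebraicGeometry.Smooth S.hom → topologicalKrullDim S.left = 1 →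
      (∀ s : ComplexPoints S, ∃ A' : AbelianVariety ℂ, A'.dim = 6 ∧ Nonempty (A'.X ≅ fiberOver f s)) →
      (∃ e : S ⟶ 𝒳, e ≫ f = 𝟙 S) →
      ∀ (W : complexBetti 𝒳 (2 * 3)),
        (∀ s : ComplexPoints S, IsRationalClass (complexBetti.map (fiberι f s) (2 * 3) W) ∧
          IsOfHodgeType 6 (fiberOver f s) (2 * 3) 3 3 (complexBetti.map (fiberι f s) (2 * 3) W)) →
        ∀ s₀ : ComplexPoints S,
          complexBetti.map (fiberι f s₀) (2 * 3) W ∈ algebraicClasses (fiberOver f s₀) 3 →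
          (¬ ∀ s : ComplexPoints S,
            complexBetti.map (fiberι f s) (2 * 3) W ∈ algebraicClasses (fiberOver f s) 3 ∧
            complexBetti.map (fiberι f s) (2 * 3) W ∈ divisorClassesSpan (fiberOver f s) 6 3) →
          ¬ HasServedFibre 6 3 (fun X θ ↦ secantQuotientAnchorsPinned X θ) (fun X θ ↦ secantQuotientServedClassesPinned X θ) f W :=
  not_forall_cell_not_hasServedFibre_63_secantQuotientPinned_of_pinned_of_supply hM hsup

end Prime

/-! ## §3 Seeds at every level: a carried pinned-served direction at a level-`d` pinned anchor, every even `d ≥ 4` -/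

/-- **The identity chart of a secant–quotient datum is a level-`D.d` anchor WITH ITS CLASS** (`Markman2025.IsSecantQuotientAnchorWith D.d D.Y.X
(h_Y θ₀)`) for every polarisation class `θ₀` of `Θ` — the carriers' scheme-level envelope, at the chart `Iso.refl`.
[cite: Markman2025SecantWeil, §1.3 (p. 5), §1.5 (p. 7) and §3.2 Cor. 3.2.3] -/
theorem SecantQuotientDatum.isSecantQuotientAnchorWith_hY (D : SecantQuotientDatum) {θ₀ : complexBetti D.𝒥.J.X 2}
    (hθ₀ : D.𝒥.J.IsPolarizationClassOf D.Θ θ₀) : IsSecantQuotientAnchorWith D.d D.Y.X (D.hY θ₀) := by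
  -- `show` first unfolds `D.Y` so that the identity chart's source and target agree syntactically for `complexBetti.map_id`
  show IsSecantQuotientAnchorWith D.d (secantQuotient D.𝒥.J D.isAmple D.G₁ D.G₂ D.succ_ne_zero D.G₁_le D.G₂_le).X _
  refine ⟨D.C, D.smooth, D.𝒥, D.dim_J, D.Θ, D.riemann, D.principal, θ₀, hθ₀, D.G₁, D.G₂, D.G₁_le, D.G₂_le,
    D.cyclic₁, D.card₁, D.cyclic₂, D.card₂, D.disjoint, Iso.refl _, ?_⟩
  rw [Iso.refl_hom, complexBetti.map_id]; rfl

/-- **SEEDS AT EVERY LEVEL, modulo L1″(C, Adm)**: for every even `d ≥ 4` there are a pinned secant–quotient anchor `(X, θ)` OF LEVEL `d`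
(`IsSecantQuotientAnchorWith d X θ`) and a pinned-served class `γ ∈ 𝔖^pin X θ`, rational and algebraic, CARRIED by a `tw C Adm`-datum modulo the
`θ`-ray: `γ ∈ AbelianAll.carriedClasses (twistedReflexiveClass C Adm) 6 3 X θ` (`a = 1`; print's `κ₃(𝓔̄ ⊗ det^{-1/8d}) = γ₀ + c₃h³`). Print's
ONE direction at print's ONE anchor per level, in the currency of the André column's carrier nodes. [cite: Markman2025SecantWeil, Thm. 1.4.1 (item 4), §1.5 and Lemma 9.3.11]
[cite: Bloch1972Semiregularity, Remark (7.5)] -/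
theorem exists_carried_secantQuotientPinned_of_pinned (hM : Markman2025_secantQuotient_twistedCarrier_onJacobian_pinned C Adm)
    {d : ℕ} (hd : Even d) (h4 : 4 ≤ d) :
    ∃ (X : SchemeOver ℂ) (θ : complexBetti X 2) (γ : complexBetti X (2 * 3)),
      IsSecantQuotientAnchorWith d X θ ∧ γ ∈ secantQuotientServedClassesPinned X θ ∧ IsRationalClass γ ∧ γ ∈ algebraicClasses X 3 ∧
      γ ∈ carriedClasses (twistedReflexiveClass C Adm) 6 3 X θ := by
  obtain ⟨D, θ₀, γ, hDd, hθ₀, hW, hγalg, ⟨I, κ, c, h3, hκ, hκ3, hκk⟩, -⟩ := exists_pinnedAnchor_of_pinned hM hd h4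
  subst hDd
  exact ⟨D.Y.X, D.hY θ₀, γ, D.isSecantQuotientAnchorWith_hY hθ₀, hW, hW.isRationalClass, hγalg, I, κ, 1, c, h3, hκ, one_ne_zero,
    by rw [one_smul]; exact hκ3, hκk⟩

/-! ## §4 The transfer junction: seeds ∧ same-level transfer ⟹ the 2a-body; L1″ ∧ transfer ⟹ 2a‴ ∕ 2a″ -/

section Transfer

variable {𝒪 : ObjClass}

/-- **SEEDS ∧ TRANSFER ⟹ THE ANCHORED-CARRIER STATEMENT AT THE PINNED DATA** (door-generic, fact-free). If every even level `d ≥ 4` is SEEDED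
— some level-`d` pinned anchor `(X', θ')` carries an `𝒪`-datum in some pinned-served rational direction `w'` — and `𝒪`-data TRANSFER
between pinned-served rational triples of the same level (from `(X', θ', w')` to `(X, θ, w)` whenever both anchors are level-`d` anchors with their
class), then `AnchoredCarrierAt 𝒪 6 3 𝔄^pin 𝔖^pin`: a pinned anchor has the level of its datum (`exists_isSecantQuotientAnchorWith`, even `≥ 4`),
that level is seeded, transfer. [cite: Markman2025SecantWeil, §1.5 (p. 7), Thm. 1.4.1 (item 4) and Thm. 1.5.1] [cite: Bloch1972Semiregularity, Remark (7.5)] -/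
theorem anchoredCarrierAt_secantQuotientPinned_of_seeds_of_transfer
    (hseed : ∀ d : ℕ, Even d → 4 ≤ d →
      ∃ (X' : SchemeOver ℂ) (θ' : complexBetti X' 2) (w' : complexBetti X' (2 * 3)),
        IsSecantQuotientAnchorWith d X' θ' ∧ w' ∈ secantQuotientServedClassesPinned X' θ' ∧ IsRationalClass w' ∧
        w' ∈ carriedClasses 𝒪 6 3 X' θ')
    (htr : ∀ (d : ℕ) ⦃X X' : SchemeOver ℂ⦄ ⦃θ : complexBetti X 2⦄ ⦃θ' : complexBetti X' 2⦄
      ⦃w : complexBetti X (2 * 3)⦄ ⦃w' : complexBetti X' (2 * 3)⦄,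
      IsSecantQuotientAnchorWith d X θ → w ∈ secantQuotientServedClassesPinned X θ → IsRationalClass w →
      IsSecantQuotientAnchorWith d X' θ' → w' ∈ secantQuotientServedClassesPinned X' θ' → IsRationalClass w' →
      w' ∈ carriedClasses 𝒪 6 3 X' θ' → w ∈ carriedClasses 𝒪 6 3 X θ) :
    AnchoredCarrierAt 𝒪 6 3 (fun X θ ↦ secantQuotientAnchorsPinned X θ) (fun X θ ↦ secantQuotientServedClassesPinned X θ) := by
  intro X θ _ w hw hwQ
  obtain ⟨d, hd, h4, hXd⟩ := IsSecantQuotientWeilClassAtPinned.exists_isSecantQuotientAnchorWith hw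
  obtain ⟨X', θ', w', hX'd, hw', hw'Q, hw'c⟩ := hseed d hd h4
  exact htr d hXd hw hwQ hX'd hw' hw'Q hw'c

/-- **Conversely the 2a-body makes the transfer hypothesis trivially true** (its conclusion holds outright at every pinned-served rational
triple) — the transfer is implied by 2a, so «2a = seeds ∧ transfer» loses nothing. [cite: Bloch1972Semiregularity, Remark (7.5)] -/
theorem transfer_of_anchoredCarrierAt_secantQuotientPinned
    (h : AnchoredCarrierAt 𝒪 6 3 (fun X θ ↦ secantQuotientAnchorsPinned X θ) (fun X θ ↦ secantQuotientServedClassesPinned X θ)) :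
    ∀ (d : ℕ) ⦃X X' : SchemeOver ℂ⦄ ⦃θ : complexBetti X 2⦄ ⦃θ' : complexBetti X' 2⦄
      ⦃w : complexBetti X (2 * 3)⦄ ⦃w' : complexBetti X' (2 * 3)⦄,
      IsSecantQuotientAnchorWith d X θ → w ∈ secantQuotientServedClassesPinned X θ → IsRationalClass w →
      IsSecantQuotientAnchorWith d X' θ' → w' ∈ secantQuotientServedClassesPinned X' θ' → IsRationalClass w' →
      w' ∈ carriedClasses 𝒪 6 3 X' θ' → w ∈ carriedClasses 𝒪 6 3 X θ :=
  fun _ X _ θ _ w _ _ hw hwQ _ _ _ _ ↦ h X θ ⟨w, hw⟩ w hw hwQ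

/-- The seeds alone make the transfer hypothesis EQUIVALENT to the 2a-body. [cite: Bloch1972Semiregularity, Remark (7.5)] [cite: Markman2025SecantWeil, Thm. 1.4.1] -/
theorem anchoredCarrierAt_secantQuotientPinned_iff_transfer_of_seeds
    (hseed : ∀ d : ℕ, Even d → 4 ≤ d →
      ∃ (X' : SchemeOver ℂ) (θ' : complexBetti X' 2) (w' : complexBetti X' (2 * 3)),
        IsSecantQuotientAnchorWith d X' θ' ∧ w' ∈ secantQuotientServedClassesPinned X' θ' ∧ IsRationalClass w' ∧
        w' ∈ carriedClasses 𝒪 6 3 X' θ') :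
    AnchoredCarrierAt 𝒪 6 3 (fun X θ ↦ secantQuotientAnchorsPinned X θ) (fun X θ ↦ secantQuotientServedClassesPinned X θ) ↔
      ∀ (d : ℕ) ⦃X X' : SchemeOver ℂ⦄ ⦃θ : complexBetti X 2⦄ ⦃θ' : complexBetti X' 2⦄
        ⦃w : complexBetti X (2 * 3)⦄ ⦃w' : complexBetti X' (2 * 3)⦄,
        IsSecantQuotientAnchorWith d X θ → w ∈ secantQuotientServedClassesPinned X θ → IsRationalClass w →
        IsSecantQuotientAnchorWith d X' θ' → w' ∈ secantQuotientServedClassesPinned X' θ' → IsRationalClass w' →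
        w' ∈ carriedClasses 𝒪 6 3 X' θ' → w ∈ carriedClasses 𝒪 6 3 X θ :=
  ⟨transfer_of_anchoredCarrierAt_secantQuotientPinned, anchoredCarrierAt_secantQuotientPinned_of_seeds_of_transfer hseed⟩

end Transfer

/-- **L1″(C, Adm) ∧ TRANSFER ⟹ THE 2a-BODY AT THE DOOR `tw C Adm`** (any `Adm`): print supplies the seeds (§3), the transfer hypothesis does the rest.
[cite: Markman2025SecantWeil, Thm. 1.4.1 (item 4), §1.5 and Thm. 1.5.1] [cite: Bloch1972Semiregularity, Remark (7.5)] -/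
theorem anchoredCarrierAt_secantQuotientPinned_of_pinned_of_transfer
    (hM : Markman2025_secantQuotient_twistedCarrier_onJacobian_pinned C Adm)
    (htr : ∀ (d : ℕ) ⦃X X' : SchemeOver ℂ⦄ ⦃θ : complexBetti X 2⦄ ⦃θ' : complexBetti X' 2⦄
      ⦃w : complexBetti X (2 * 3)⦄ ⦃w' : complexBetti X' (2 * 3)⦄,
      IsSecantQuotientAnchorWith d X θ → w ∈ secantQuotientServedClassesPinned X θ → IsRationalClass w →
      IsSecantQuotientAnchorWith d X' θ' → w' ∈ secantQuotientServedClassesPinned X' θ' → IsRationalClass w' →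
      w' ∈ carriedClasses (twistedReflexiveClass C Adm) 6 3 X' θ' → w ∈ carriedClasses (twistedReflexiveClass C Adm) 6 3 X θ) :
    AnchoredCarrierAt (twistedReflexiveClass C Adm) 6 3 (fun X θ ↦ secantQuotientAnchorsPinned X θ)
      (fun X θ ↦ secantQuotientServedClassesPinned X θ) :=
  anchoredCarrierAt_secantQuotientPinned_of_seeds_of_transfer
    (fun d hd h4 ↦ by
      obtain ⟨X', θ', w', hX', hw', hw'Q, -, hw'c⟩ := exists_carried_secantQuotientPinned_of_pinned hM hd h4
      exact ⟨X', θ', w', hX', hw', hw'Q, hw'c⟩)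
    htr

/-- **STUB 2a‴ FROM PRINT AND THE TRANSFER**: `L1″(C, AdmTw′) ∧ transfer(tw C AdmTw′) ⟹ SecantQuotientAnchorCarrier63PinnedPrime C` — the
`(6,3)` anchored-carrier stub of skeleton v3.3 (item stmt-HodgeConjecture-20707) is print's pinned claim at the primed door plus the same-level
transfer of `AdmTw′`-data to every pinned anchor and every rational pinned-served Weil direction (named in the companion definitions file).
Nothing here says L1″ or the transfer holds. [cite: Markman2025SecantWeil, Thm. 1.4.1 (item 4), §1.5, Thm. 1.5.1 and Lemma 9.3.11]
[cite: Bloch1972Semiregularity, Remark (7.5)] [cite: BuchweitzFlenner2003, §5 Thm. 5.1] -/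
theorem secantQuotientAnchorCarrier63PinnedPrime_of_pinned_of_transfer
    (hM : Markman2025_secantQuotient_twistedCarrier_onJacobian_pinned C
      (fun n X₀ I E => Summit.Ventures.HSemireg.gluableSigmaAdmissible n X₀ I E ∨
        Literature.AlgebraicGeometry.HodgeTheory.bfSingleAdmissible' n X₀ I E))
    (htr : ∀ (d : ℕ) ⦃X X' : SchemeOver ℂ⦄ ⦃θ : complexBetti X 2⦄ ⦃θ' : complexBetti X' 2⦄
      ⦃w : complexBetti X (2 * 3)⦄ ⦃w' : complexBetti X' (2 * 3)⦄,
      IsSecantQuotientAnchorWith d X θ → w ∈ secantQuotientServedClassesPinned X θ → IsRationalClass w →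
      IsSecantQuotientAnchorWith d X' θ' → w' ∈ secantQuotientServedClassesPinned X' θ' → IsRationalClass w' →
      w' ∈ carriedClasses (twistedReflexiveClass C
          (fun n X₀ I E => Summit.Ventures.HSemireg.gluableSigmaAdmissible n X₀ I E ∨
            Literature.AlgebraicGeometry.HodgeTheory.bfSingleAdmissible' n X₀ I E)) 6 3 X' θ' →
        w ∈ carriedClasses (twistedReflexiveClass C
          (fun n X₀ I E => Summit.Ventures.HSemireg.gluableSigmaAdmissible n X₀ I E ∨
            Literature.AlgebraicGeometry.HodgeTheory.bfSingleAdmissible' n X₀ I E)) 6 3 X θ) :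
    SecantQuotientAnchorCarrier63PinnedPrime C :=
  anchoredCarrierAt_secantQuotientPinned_of_pinned_of_transfer hM htr

/-- **The aside twin at the door of record**: `L1″(C, AdmTw) ∧ transfer(tw C AdmTw) ⟹ SecantQuotientAnchorCarrier63Pinned C` (stub 2a″ of
skeleton v3.1, item stmt-HodgeConjecture-19787). [cite: Markman2025SecantWeil, Thm. 1.4.1 (item 4), §1.5 and Thm. 1.5.1] [cite: Bloch1972Semiregularity, Remark (7.5)] -/
theorem secantQuotientAnchorCarrier63Pinned_of_pinned_of_transfer
    (hM : Markman2025_secantQuotient_twistedCarrier_onJacobian_pinned C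
      (fun n X₀ I E => Summit.Ventures.HSemireg.gluableSigmaAdmissible n X₀ I E ∨
        Literature.AlgebraicGeometry.HodgeTheory.bfSingleAdmissible n X₀ I E))
    (htr : ∀ (d : ℕ) ⦃X X' : SchemeOver ℂ⦄ ⦃θ : complexBetti X 2⦄ ⦃θ' : complexBetti X' 2⦄
      ⦃w : complexBetti X (2 * 3)⦄ ⦃w' : complexBetti X' (2 * 3)⦄,
      IsSecantQuotientAnchorWith d X θ → w ∈ secantQuotientServedClassesPinned X θ → IsRationalClass w →
      IsSecantQuotientAnchorWith d X' θ' → w' ∈ secantQuotientServedClassesPinned X' θ' → IsRationalClass w' →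
      w' ∈ carriedClasses (twistedReflexiveClass C
          (fun n X₀ I E => Summit.Ventures.HSemireg.gluableSigmaAdmissible n X₀ I E ∨
            Literature.AlgebraicGeometry.HodgeTheory.bfSingleAdmissible n X₀ I E)) 6 3 X' θ' →
        w ∈ carriedClasses (twistedReflexiveClass C
          (fun n X₀ I E => Summit.Ventures.HSemireg.gluableSigmaAdmissible n X₀ I E ∨
            Literature.AlgebraicGeometry.HodgeTheory.bfSingleAdmissible n X₀ I E)) 6 3 X θ) :
    SecantQuotientAnchorCarrier63Pinned C :=
  anchoredCarrierAt_secantQuotientPinned_of_pinned_of_transfer hM htr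

/-- **STUB 2a‴ IMPLIES THE TRANSFER at the primed door** — so, given L1″(C, AdmTw′), the stub and the transfer are EQUIVALENT
(`…_iff_transfer_of_pinnedPrime`). [cite: Bloch1972Semiregularity, Remark (7.5)] [cite: Markman2025SecantWeil, Thm. 1.4.1] -/
theorem transfer_of_secantQuotientAnchorCarrier63PinnedPrime (h : SecantQuotientAnchorCarrier63PinnedPrime C) :
    ∀ (d : ℕ) ⦃X X' : SchemeOver ℂ⦄ ⦃θ : complexBetti X 2⦄ ⦃θ' : complexBetti X' 2⦄
      ⦃w : complexBetti X (2 * 3)⦄ ⦃w' : complexBetti X' (2 * 3)⦄,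
      IsSecantQuotientAnchorWith d X θ → w ∈ secantQuotientServedClassesPinned X θ → IsRationalClass w →
      IsSecantQuotientAnchorWith d X' θ' → w' ∈ secantQuotientServedClassesPinned X' θ' → IsRationalClass w' →
      w' ∈ carriedClasses (twistedReflexiveClass C
          (fun n X₀ I E => Summit.Ventures.HSemireg.gluableSigmaAdmissible n X₀ I E ∨
            Literature.AlgebraicGeometry.HodgeTheory.bfSingleAdmissible' n X₀ I E)) 6 3 X' θ' →
        w ∈ carriedClasses (twistedReflexiveClass C
          (fun n X₀ I E => Summit.Ventures.HSemireg.gluableSigmaAdmissible n X₀ I E ∨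
            Literature.AlgebraicGeometry.HodgeTheory.bfSingleAdmissible' n X₀ I E)) 6 3 X θ :=
  transfer_of_anchoredCarrierAt_secantQuotientPinned h

/-- **Modulo L1″(C, AdmTw′): stub 2a‴ ⟺ the transfer** — the stub is print plus exactly this node. [cite: Markman2025SecantWeil, Thm. 1.4.1 (item 4), §1.5 and Thm. 1.5.1]
[cite: Bloch1972Semiregularity, Remark (7.5)] -/
theorem secantQuotientAnchorCarrier63PinnedPrime_iff_transfer_of_pinnedPrime
    (hM : Markman2025_secantQuotient_twistedCarrier_onJacobian_pinned C
      (fun n X₀ I E => Summit.Ventures.HSemireg.gluableSigmaAdmissible n X₀ I E ∨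
        Literature.AlgebraicGeometry.HodgeTheory.bfSingleAdmissible' n X₀ I E)) :
    SecantQuotientAnchorCarrier63PinnedPrime C ↔
      ∀ (d : ℕ) ⦃X X' : SchemeOver ℂ⦄ ⦃θ : complexBetti X 2⦄ ⦃θ' : complexBetti X' 2⦄
        ⦃w : complexBetti X (2 * 3)⦄ ⦃w' : complexBetti X' (2 * 3)⦄,
        IsSecantQuotientAnchorWith d X θ → w ∈ secantQuotientServedClassesPinned X θ → IsRationalClass w →
        IsSecantQuotientAnchorWith d X' θ' → w' ∈ secantQuotientServedClassesPinned X' θ' → IsRationalClass w' →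
        w' ∈ carriedClasses (twistedReflexiveClass C
            (fun n X₀ I E => Summit.Ventures.HSemireg.gluableSigmaAdmissible n X₀ I E ∨
              Literature.AlgebraicGeometry.HodgeTheory.bfSingleAdmissible' n X₀ I E)) 6 3 X' θ' →
          w ∈ carriedClasses (twistedReflexiveClass C
            (fun n X₀ I E => Summit.Ventures.HSemireg.gluableSigmaAdmissible n X₀ I E ∨
              Literature.AlgebraicGeometry.HodgeTheory.bfSingleAdmissible' n X₀ I E)) 6 3 X θ :=
  ⟨transfer_of_secantQuotientAnchorCarrier63PinnedPrime,
    secantQuotientAnchorCarrier63PinnedPrime_of_pinned_of_transfer hM⟩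

end Summit.HodgeConjecture.HodgeConjecture.Ring2.SemiregularRepresentatives

end
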